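import Literature.MeasureTheory.Radon.WeakSequentialCompletenessTight
import Mathlib.MeasureTheory.Measure.Prokhorov
import HarnessLib


/-!
# Weak sequential completeness of `P(X)`, `X` Polish — III: the limit is a measure; filter form

Topic `MeasureTheory/Radon`; namespace `Literature.MeasureTheory.Radon`.  Conclusion of the classical weak
sequential completeness theorem (A. D. Alexandroff 1943; V. S. Varadarajan, *Measures on topological
spaces*, Mat. Sb. 55 (1961) = AMS Transl. (2) 48 (1965), Part II; V. I. Bogachev, *Measure Theory* II
(Springer 2007), §8.7 "Weak sequential completeness"):

* `exists_probabilityMeasure_forall_tendsto_integral` — on a Polish metric space, if `∫ f dμₙ` converges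
  for every bounded continuous `f`, then the Borel probability measures `μₙ` converge weakly to SOME Borel
  probability measure (tightness from `WeakSequentialCompletenessTight` + Mathlib's Prokhorov theorem
  `isCompact_closure_of_isTightMeasureSet` and the metrisability of `ProbabilityMeasure X`);
* `exists_finite_forall_eventually_measure_compl_le` — filter form of the tightness along a countably
  generated filter (e.g. a mesh `δ → 0⁺`): finitely many `r`-balls carry all but `ε` of the mass of `μᵢ`,
  eventually.

Everything proved, standard axioms. [folklore]
-/

noncomputable section

open MeasureTheory Filter Topology Set Metric Function
open scoped ENNReal NNReal BoundedContinuousFunction Topology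

namespace Literature.MeasureTheory.Radon

variable {X : Type*} [PseudoMetricSpace X] [MeasurableSpace X] [BorelSpace X]


/-- **Weak sequential completeness of `P(X)`, `X` Polish** (Alexandroff–Varadarajan; Bogachev, *Measure
Theory* II, §8.7): if `∫ f dμₙ` converges for every bounded continuous `f`, then the Borel probability
measures `μₙ` converge weakly to some Borel probability measure `ν` — the limit functional
`f ↦ lim ∫ f dμₙ` is represented by a probability measure.  Tightness
(`isTightMeasureSet_range_of_forall_tendsto_integral`) + Prokhorov (Mathlib
`isCompact_closure_of_isTightMeasureSet`) give a weakly convergent subsequence; its limit represents the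
limit functional, hence is the weak limit of the whole sequence. [folklore] -/
theorem exists_probabilityMeasure_forall_tendsto_integral {Y : Type*} [MetricSpace Y] [CompleteSpace Y]
    [SecondCountableTopology Y] [MeasurableSpace Y] [BorelSpace Y]
    {μ : ℕ → Measure Y} [hμ : ∀ n, IsProbabilityMeasure (μ n)]
    (h : ∀ f : Y →ᵇ ℝ, ∃ L : ℝ, Tendsto (fun n => ∫ x, f x ∂μ n) atTop (𝓝 L)) :
    ∃ ν : Measure Y, IsProbabilityMeasure ν ∧
      ∀ f : Y →ᵇ ℝ, Tendsto (fun n => ∫ x, f x ∂μ n) atTop (𝓝 (∫ x, f x ∂ν)) := by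
  set P : ℕ → ProbabilityMeasure Y := fun n => ⟨μ n, hμ n⟩ with hP
  have htight : IsTightMeasureSet {((ν : ProbabilityMeasure Y) : Measure Y) | ν ∈ Set.range P} := by
    have hset : {((ν : ProbabilityMeasure Y) : Measure Y) | ν ∈ Set.range P} = Set.range μ := by
      ext ν'
      constructor
      · rintro ⟨ν, ⟨n, rfl⟩, rfl⟩
        exact ⟨n, rfl⟩
      · rintro ⟨n, rfl⟩
        exact ⟨P n, ⟨n, rfl⟩, rfl⟩
    rw [hset]
    exact isTightMeasureSet_range_of_forall_tendsto_integral h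
  have hcomp : IsCompact (closure (Set.range P)) := isCompact_closure_of_isTightMeasureSet htight
  obtain ⟨ν, -, φ, hφ, hlim⟩ :=
    hcomp.tendsto_subseq (fun n => subset_closure (Set.mem_range_self n))
  refine ⟨ν, inferInstance, fun f => ?_⟩
  obtain ⟨L, hL⟩ := h f
  have h1 : Tendsto (fun n => ∫ x, f x ∂(P (φ n) : Measure Y)) atTop
      (𝓝 (∫ x, f x ∂(ν : Measure Y))) :=
    (ProbabilityMeasure.tendsto_iff_forall_integral_tendsto.1 hlim) f
  have h2 : Tendsto (fun n => ∫ x, f x ∂μ (φ n)) atTop (𝓝 L) := hL.comp hφ.tendsto_atTop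
  have hLν : L = ∫ x, f x ∂(ν : Measure Y) := tendsto_nhds_unique h2 h1
  rw [← hLν]
  exact hL

/-- **Filter form.**  Along a countably generated filter `l` (e.g. a mesh `δ → 0⁺`), let `μᵢ` be Borel
measures on a complete separable metric space that are eventually probability measures and along which
`∫ f dμᵢ` converges for every bounded continuous `f`.  Then for every `ε > 0` and `r > 0` finitely many
`r`-balls carry all but `ε` of the mass of `μᵢ`, EVENTUALLY along `l`.  (Otherwise, along a dense sequence
`(d_j)`, pick `i_k → l` with `μ_{i_k}` putting mass `> ε` outside the `r`-balls around `d_0, …, d_k`; the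
sequence `μ_{i_k}` has convergent integrals, hence is tight by
`isTightMeasureSet_range_of_forall_tendsto_integral`, and a compact set carrying all but `ε` of every
`μ_{i_k}` lies inside finitely many of these balls — contradiction.) [folklore] -/
theorem exists_finite_forall_eventually_measure_compl_le [CompleteSpace X] [SecondCountableTopology X]
    {ι : Type*} {l : Filter ι} [l.IsCountablyGenerated] {μ : ι → Measure X}
    (hprob : ∀ᶠ i in l, IsProbabilityMeasure (μ i))
    (h : ∀ f : X →ᵇ ℝ, ∃ L : ℝ, Tendsto (fun i => ∫ x, f x ∂μ i) l (𝓝 L))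
    {ε : ℝ≥0∞} (hε : 0 < ε) {r : ℝ} (hr : 0 < r) :
    ∃ F : Set X, F.Finite ∧ ∀ᶠ i in l, μ i (⋃ x ∈ F, ball x r)ᶜ ≤ ε := by
  rcases isEmpty_or_nonempty X with hX | hX
  · refine ⟨∅, finite_empty, Eventually.of_forall fun i => ?_⟩
    rw [Set.eq_empty_of_isEmpty (⋃ x ∈ (∅ : Set X), ball x r)ᶜ, measure_empty]
    exact bot_le
  obtain ⟨d, hd⟩ := TopologicalSpace.exists_dense_seq X
  set U : ℕ → Set X := fun k => ⋃ j ∈ Set.Iic k, ball (d j) r with hU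
  by_contra hcon
  push Not at hcon
  have hbadU : ∀ k, ∃ᶠ i in l, ε < μ i (U k)ᶜ := by
    intro k
    have h1 := hcon (d '' Set.Iic k) ((Set.finite_Iic k).image d)
    have hUk : U k = ⋃ x ∈ d '' Set.Iic k, ball x r := by
      ext x
      simp only [hU, mem_iUnion, mem_image, exists_prop]
      constructor
      · rintro ⟨j, hj, hx⟩
        exact ⟨d j, ⟨j, hj, rfl⟩, hx⟩
      · rintro ⟨y, ⟨j, hj, rfl⟩, hx⟩
        exact ⟨j, hj, hx⟩
    rw [hUk]
    exact h1
  obtain ⟨b, hb⟩ := l.exists_antitone_basis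
  have hpick : ∀ k : ℕ, ∃ i, i ∈ b k ∧ IsProbabilityMeasure (μ i) ∧ ε < μ i (U k)ᶜ := by
    intro k
    have hev : ∀ᶠ i in l, i ∈ b k ∧ IsProbabilityMeasure (μ i) :=
      (show ∀ᶠ i in l, i ∈ b k from hb.1.mem_of_mem trivial).and hprob
    obtain ⟨i, hi1, hi2, hi3⟩ := ((hbadU k).and_eventually hev).exists
    exact ⟨i, hi2, hi3, hi1⟩
  choose i hib hip hiU using hpick
  have htend : Tendsto i atTop l := hb.tendsto hib
  haveI : ∀ k, IsProbabilityMeasure (μ (i k)) := hip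
  have hconv : ∀ f : X →ᵇ ℝ, ∃ L : ℝ, Tendsto (fun k => ∫ x, f x ∂μ (i k)) atTop (𝓝 L) := fun f => by
    obtain ⟨L, hL⟩ := h f
    exact ⟨L, hL.comp htend⟩
  have htight := isTightMeasureSet_range_of_forall_tendsto_integral (μ := fun k => μ (i k)) hconv
  obtain ⟨K, hK, hKμ⟩ := (isTightMeasureSet_iff_exists_isCompact_measure_compl_le.1 htight) ε hε
  have hcover : K ⊆ ⋃ j, ball (d j) r := fun x _ => by
    obtain ⟨j, hj⟩ := (Metric.denseRange_iff.1 hd) x r hr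
    exact mem_iUnion.2 ⟨j, mem_ball.2 hj⟩
  obtain ⟨t, ht⟩ := hK.elim_finite_subcover (fun j => ball (d j) r) (fun _ => isOpen_ball) hcover
  set k0 : ℕ := t.sup id with hk0
  have hKU : K ⊆ U k0 := by
    intro x hx
    obtain ⟨j, hj, hxj⟩ := mem_iUnion₂.1 (ht hx)
    exact mem_biUnion (show j ∈ Set.Iic k0 from Finset.le_sup (f := id) hj) hxj
  have h1 : μ (i k0) (U k0)ᶜ ≤ ε := (measure_mono (compl_subset_compl.2 hKU)).trans (hKμ _ ⟨k0, rfl⟩)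
  exact (lt_irrefl _) ((hiU k0).trans_le h1)

end Literature.MeasureTheory.Radon

end
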